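import Literature.Topology.FourManifolds.GradientLikeDynamics
import Literature.Topology.FourManifolds.GradientLikeExistence
import Mathlib.Analysis.Calculus.BumpFunction.FiniteDimension
import HarnessLib

/-!
# The normalised Milnor model field: unit speed off a small core, Milnor's field inside

Topic `Literature/Topology/FourManifolds` (fact seat
`provefact-Literature.Topology.FourManifolds.IsHandlebody.exists_isBoundaryGluing_sphere`, step F2b of
the Lickorish–Wallace DAG; model layer of the handle-extension step of the classification of
handlebodies).  Everything here is **proved**; no named facts.

Milnor, *Lectures on the h-cobordism theorem* (1965), uses two normalisations of a gradient-like
field `ξ` for a Morse function `f`: near a critical point the model field `ξ = (-x⃗, y⃗)` of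
Def. 3.1 (2) (`Literature.Topology.FourManifolds.milnorModelField`, for the quadratic normal form
`f = f(p) - |x⃗|² + |y⃗|²`, `Literature.Topology.FourManifolds.milnorQuadratic`), and away from the
critical points the unit-speed field `ξ̂ = ξ / ξ(f)` (proof of Thm. 3.4, PDF p. 13: "Then
`ξ̂(f) ≡ 1`", so that the flow raises `f` at unit rate).  The handle-extension step wants both
at once, with the transition made **inside the coordinate chart by a formula depending on the
coordinates only** — so that the fields on two manifolds read in their Milnor charts are the
*same* model field and the charts conjugate the flows.  This file defines that model field on
`ℝᵐ`:

* `Literature.Topology.FourManifolds.speedFactor r u = χ_r(u) + (1 - χ_r(u)) / (2‖u‖²)` with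
  `χ_r` a fixed bump (`= 1` on `B̄(0, r)`, `= 0` off `B(0, 2r)`), and
  `Literature.Topology.FourManifolds.handleModelField k r u = speedFactor r u • milnorModelField k u`;
* smoothness (`contDiff_speedFactor`, `contDiff_handleModelField`), `handleModelField = milnorModelField`
  on `B̄(0, r)`, positivity of the speed factor;
* **speed**: `D(milnorQuadratic k)(u)(handleModelField k r u) = speedFactor r u · 2‖u‖²`
  (`fderiv_milnorQuadratic_handleModelField`), `= 1` for `2r ≤ ‖u‖` and `> 0` for `u ≠ 0` —
  Milnor's `ξ(f) = 2|u|²` for the model field (`fderiv_milnorQuadratic_milnorModelField`);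
* **conservation of `|x⃗|²|y⃗|²`**: `D(sqSumLT k · sqSumGE k)(u)(handleModelField k r u) = 0`
  (`fderiv_sqSumLT_mul_sqSumGE_handleModelField`) — the invariant of the model trajectories
  `(e^{-t}x⃗, e^{t}y⃗)` (Milnor, proof of Thm. 3.12, PDF p. 18), unchanged by the scalar
  reparametrisation.

## References

* J. Milnor, *Lectures on the h-cobordism theorem* (1965), Def. 3.1, proofs of Thm. 3.4 (PDF
  p. 13) and Thm. 3.12 (PDF p. 18). [MilnorHCobordism1965]
-/

open scoped ContDiff Topology
open Set Function Metric

noncomputable section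

namespace Literature.Topology.FourManifolds

variable {m : ℕ}

/-- Local notation: `𝔼 m` is the model Euclidean space `EuclideanSpace ℝ (Fin m)`. -/
local notation "𝔼 " m:arg => EuclideanSpace ℝ (Fin m)

/-! ### The bump and the speed factor -/

/-- The fixed bump `χ_r`: `= 1` on `B̄(0, r)`, `= 0` off `B(0, 2r)` (`r > 0`). [folklore] -/
def handleCoreBump {r : ℝ} (hr : 0 < r) : ContDiffBump (0 : 𝔼 m) := ⟨r, 2 * r, hr, by linarith⟩

/-- `χ_r = 1` on the closed ball of radius `r`. [folklore] -/
theorem handleCoreBump_eq_one {r : ℝ} (hr : 0 < r) {u : 𝔼 m} (hu : ‖u‖ ≤ r) : handleCoreBump hr u = 1 :=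
  (handleCoreBump hr).one_of_mem_closedBall (by rw [mem_closedBall, dist_zero_right]; exact hu)

/-- `χ_r = 0` off the open ball of radius `2r`. [folklore] -/
theorem handleCoreBump_eq_zero {r : ℝ} (hr : 0 < r) {u : 𝔼 m} (hu : 2 * r ≤ ‖u‖) : handleCoreBump hr u = 0 :=
  (handleCoreBump hr).zero_of_le_dist (by rw [dist_zero_right]; exact hu)

/-- **The speed factor** `g_r(u) = χ_r(u) + (1 - χ_r(u)) / (2‖u‖²)`: `= 1` near `0`,
`= 1/(2‖u‖²)` off `B(0, 2r)`. [cite: MilnorHCobordism1965, proof of Thm. 3.4 (PDF p. 13)] -/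
def speedFactor {r : ℝ} (hr : 0 < r) (u : 𝔼 m) : ℝ :=
  handleCoreBump hr u + (1 - handleCoreBump hr u) * (2 * ‖u‖ ^ 2)⁻¹

/-- Near the origin the speed factor is `1`. [folklore] -/
theorem speedFactor_eq_one {r : ℝ} (hr : 0 < r) {u : 𝔼 m} (hu : ‖u‖ ≤ r) : speedFactor hr u = 1 := by
  simp [speedFactor, handleCoreBump_eq_one hr hu]

/-- Off `B(0, 2r)` the speed factor is `1/(2‖u‖²)`. [folklore] -/
theorem speedFactor_eq_inv {r : ℝ} (hr : 0 < r) {u : 𝔼 m} (hu : 2 * r ≤ ‖u‖) :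
    speedFactor hr u = (2 * ‖u‖ ^ 2)⁻¹ := by
  simp [speedFactor, handleCoreBump_eq_zero hr hu]

/-- The speed factor is positive. [folklore] -/
theorem speedFactor_pos {r : ℝ} (hr : 0 < r) (u : 𝔼 m) : 0 < speedFactor hr u := by
  unfold speedFactor
  have h0 : 0 ≤ handleCoreBump hr u := (handleCoreBump hr).nonneg
  have h1 : handleCoreBump hr u ≤ 1 := (handleCoreBump hr).le_one
  by_cases hu : ‖u‖ ≤ r
  · rw [handleCoreBump_eq_one hr hu]; norm_num
  · have hpos : 0 < (2 * ‖u‖ ^ 2)⁻¹ := by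
      have : 0 < ‖u‖ := hr.trans (not_le.1 hu)
      positivity
    rcases h1.lt_or_eq with hlt | heq
    · have : 0 < (1 - handleCoreBump hr u) * (2 * ‖u‖ ^ 2)⁻¹ := mul_pos (by linarith) hpos
      linarith
    · rw [heq]; norm_num

/-- The speed factor is smooth: it is `1` on the open ball `B(0, r)` and a smooth expression on
`{u ≠ 0}`, two open sets covering `ℝᵐ`. [folklore] -/
theorem contDiff_speedFactor {r : ℝ} (hr : 0 < r) : ContDiff ℝ ∞ (speedFactor (m := m) hr) := by
  rw [contDiff_iff_contDiffAt]
  intro u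
  by_cases hu : u = 0
  · -- near `0` the factor is constant
    have hev : speedFactor (m := m) hr =ᶠ[𝓝 u] fun _ => 1 := by
      rw [hu]
      filter_upwards [Metric.ball_mem_nhds (0 : 𝔼 m) hr] with v hv
      exact speedFactor_eq_one hr (le_of_lt (by simpa using hv))
    exact contDiffAt_const.congr_of_eventuallyEq hev
  · have hχ : ContDiffAt ℝ ∞ (fun v : 𝔼 m => (handleCoreBump hr : 𝔼 m → ℝ) v) u :=
      (handleCoreBump hr).contDiff.contDiffAt
    have hn : ContDiffAt ℝ ∞ (fun v : 𝔼 m => (2 * ‖v‖ ^ 2)⁻¹) u := by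
      refine ContDiffAt.inv ?_ (by positivity)
      exact contDiffAt_const.mul ((contDiffAt_id.norm_sq ℝ).congr_of_eventuallyEq
        (Filter.Eventually.of_forall fun v => by simp))
    exact hχ.add ((contDiffAt_const.sub hχ).mul hn)

/-! ### The normalised model field -/

/-- **The normalised Milnor model field** `Ê(u) = g_r(u) · (-x⃗, y⃗)`: Milnor's model field of
index `k` (Def. 3.1 (2)) inside `B̄(0, r)`, rescaled to unit speed for the quadratic normal
form off `B(0, 2r)`. [cite: MilnorHCobordism1965, Def. 3.1 and proof of Thm. 3.4 (PDF p. 13)] -/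
def handleModelField (k : ℕ) {r : ℝ} (hr : 0 < r) (u : 𝔼 m) : 𝔼 m :=
  speedFactor hr u • milnorModelField k u

/-- Inside `B̄(0, r)` the normalised field is Milnor's model field. [cite: MilnorHCobordism1965, Def. 3.1] -/
theorem handleModelField_eq_of_norm_le (k : ℕ) {r : ℝ} (hr : 0 < r) {u : 𝔼 m} (hu : ‖u‖ ≤ r) :
    handleModelField k hr u = milnorModelField k u := by
  rw [handleModelField, speedFactor_eq_one hr hu, one_smul]

/-- The normalised field vanishes at the origin only where Milnor's does; at `0` it is `0`.
[folklore] -/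
@[simp] theorem handleModelField_zero (k : ℕ) {r : ℝ} (hr : 0 < r) :
    handleModelField (m := m) k hr 0 = 0 := by
  simp [handleModelField]

/-- The normalised model field is smooth. [folklore] -/
theorem contDiff_handleModelField (k : ℕ) {r : ℝ} (hr : 0 < r) :
    ContDiff ℝ ∞ (handleModelField (m := m) k hr) :=
  (contDiff_speedFactor hr).smul (contDiff_milnorModelField k)

/-! ### Speed -/

/-- **Speed of Milnor's model field for the quadratic form**: `DQ(u)(ξ(u)) = 2‖u‖²`
(Milnor, proof of Lemma 3.2, PDF p. 12). [cite: MilnorHCobordism1965, proof of Lemma 3.2 (PDF p. 12)] -/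
theorem fderiv_milnorQuadratic_apply_milnorModelField (k : ℕ) (u : 𝔼 m) :
    fderiv ℝ (milnorQuadratic (m := m) k) u (milnorModelField k u) = 2 * ‖u‖ ^ 2 := by
  rw [(hasFDerivAt_milnorQuadratic k u).fderiv, fderiv_milnorQuadratic_milnorModelField,
    EuclideanSpace.real_norm_sq_eq]

/-- **Speed of the normalised field**: `DQ(u)(Ê(u)) = g_r(u) · 2‖u‖²`. [cite: MilnorHCobordism1965, proof of Thm. 3.4 (PDF p. 13)] -/
theorem fderiv_milnorQuadratic_handleModelField (k : ℕ) {r : ℝ} (hr : 0 < r) (u : 𝔼 m) :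
    fderiv ℝ (milnorQuadratic (m := m) k) u (handleModelField k hr u) =
      speedFactor hr u * (2 * ‖u‖ ^ 2) := by
  rw [handleModelField, map_smul, fderiv_milnorQuadratic_apply_milnorModelField, smul_eq_mul]

/-- **Unit speed off the core**: `DQ(u)(Ê(u)) = 1` for `2r ≤ ‖u‖` ("`ξ̂(f) ≡ 1`", Milnor,
proof of Thm. 3.4). [cite: MilnorHCobordism1965, proof of Thm. 3.4 (PDF p. 13)] -/
theorem fderiv_milnorQuadratic_handleModelField_eq_one (k : ℕ) {r : ℝ} (hr : 0 < r) {u : 𝔼 m}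
    (hu : 2 * r ≤ ‖u‖) : fderiv ℝ (milnorQuadratic (m := m) k) u (handleModelField k hr u) = 1 := by
  rw [fderiv_milnorQuadratic_handleModelField, speedFactor_eq_inv hr hu]
  have : 0 < ‖u‖ := by nlinarith [norm_nonneg u]
  field_simp

/-- The speed is positive away from the origin (the only zero of the field). [cite: MilnorHCobordism1965, Def. 3.1 (1)] -/
theorem fderiv_milnorQuadratic_handleModelField_pos (k : ℕ) {r : ℝ} (hr : 0 < r) {u : 𝔼 m}
    (hu : u ≠ 0) : 0 < fderiv ℝ (milnorQuadratic (m := m) k) u (handleModelField k hr u) := by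
  rw [fderiv_milnorQuadratic_handleModelField]
  have : 0 < ‖u‖ := norm_pos_iff.2 hu
  exact mul_pos (speedFactor_pos hr u) (by positivity)

/-- The speed is at most... nonnegative everywhere. [folklore] -/
theorem fderiv_milnorQuadratic_handleModelField_nonneg (k : ℕ) {r : ℝ} (hr : 0 < r) (u : 𝔼 m) :
    0 ≤ fderiv ℝ (milnorQuadratic (m := m) k) u (handleModelField k hr u) := by
  rw [fderiv_milnorQuadratic_handleModelField]
  exact mul_nonneg (speedFactor_pos hr u).le (by positivity)

/-! ### Conservation of `|x⃗|² |y⃗|²` -/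

/-- The derivative of `|x⃗|²` on the normalised field: `-2 g_r |x⃗|²`. [cite: MilnorHCobordism1965, proof of Thm. 3.12 (PDF p. 18)] -/
theorem fderiv_sqSumLT_handleModelField (k : ℕ) {r : ℝ} (hr : 0 < r) (u : 𝔼 m) :
    fderiv ℝ (sqSumLT (m := m) k) u (handleModelField k hr u) =
      -2 * speedFactor hr u * sqSumLT k u := by
  have h : HasFDerivAt (sqSumLT (m := m) k)
      (∑ i ∈ Finset.univ.filter (fun i : Fin m => (i : ℕ) < k),
        (2 * u i) • (EuclideanSpace.proj (𝕜 := ℝ) i)) u := hasFDerivAt_sum_sq _ u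
  rw [h.fderiv, handleModelField, map_smul, fderiv_sqSumLT_milnorModelField, smul_eq_mul]
  ring

/-- The derivative of `|y⃗|²` on the normalised field: `2 g_r |y⃗|²`. [cite: MilnorHCobordism1965, proof of Thm. 3.12 (PDF p. 18)] -/
theorem fderiv_sqSumGE_handleModelField (k : ℕ) {r : ℝ} (hr : 0 < r) (u : 𝔼 m) :
    fderiv ℝ (sqSumGE (m := m) k) u (handleModelField k hr u) =
      2 * speedFactor hr u * sqSumGE k u := by
  have h : HasFDerivAt (sqSumGE (m := m) k)
      (∑ i ∈ Finset.univ.filter (fun i : Fin m => k ≤ (i : ℕ)),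
        (2 * u i) • (EuclideanSpace.proj (𝕜 := ℝ) i)) u := hasFDerivAt_sum_sq _ u
  rw [h.fderiv, handleModelField, map_smul, fderiv_sqSumGE_milnorModelField, smul_eq_mul]
  ring

/-- `|x⃗|²` and `|y⃗|²` are smooth. [folklore] -/
theorem contDiff_sqSumLT (k : ℕ) : ContDiff ℝ ∞ (sqSumLT (m := m) k) :=
  ContDiff.sum fun i _ => (EuclideanSpace.proj (𝕜 := ℝ) i).contDiff.pow 2

/-- `|y⃗|²` is smooth. [folklore] -/
theorem contDiff_sqSumGE (k : ℕ) : ContDiff ℝ ∞ (sqSumGE (m := m) k) :=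
  ContDiff.sum fun i _ => (EuclideanSpace.proj (𝕜 := ℝ) i).contDiff.pow 2

/-- **Conservation of `|x⃗|² |y⃗|²` along the normalised model field**:
`D(|x⃗|²|y⃗|²)(u)(Ê(u)) = 0` — on the model trajectories `(e^{-t}x⃗, e^{t}y⃗)` of Milnor's field
(proof of Thm. 3.12) the product is constant, and `Ê` is a scalar multiple of that field.
[cite: MilnorHCobordism1965, proof of Thm. 3.12 (PDF p. 18)] -/
theorem fderiv_sqSumLT_mul_sqSumGE_handleModelField (k : ℕ) {r : ℝ} (hr : 0 < r) (u : 𝔼 m) :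
    fderiv ℝ (fun v => sqSumLT (m := m) k v * sqSumGE k v) u (handleModelField k hr u) = 0 := by
  have hA := ((contDiff_sqSumLT (m := m) k).differentiable (by simp) u).hasFDerivAt
  have hB := ((contDiff_sqSumGE (m := m) k).differentiable (by simp) u).hasFDerivAt
  rw [(hA.fun_mul hB).fderiv, FunLike.coe_add, Pi.add_apply, FunLike.coe_smul, FunLike.coe_smul,
    Pi.smul_apply, Pi.smul_apply, fderiv_sqSumLT_handleModelField, fderiv_sqSumGE_handleModelField,
    smul_eq_mul, smul_eq_mul]
  ring

end Literature.Topology.FourManifolds
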